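import Summits.CriticalPhenomena.SAWScalingLimit.Theorems.SAWLoopFugacityFlowAvoidanceLimitCritLineMonotone
import Literature.Probability.RandomPlanarGeometry.SAWKestenPatterns

/-!
# Walk-supported plaquettes only RAISE the source-free partition function — helper of the
registered stub `isMassive_above_criticalFugacity_of_pos` (line `saw-corner-germ`, crux
`SAWLoopFugacityFlow.AvoidanceLimit`, stmt-CriticalPhenomena-10649)

The dressing penalty in L. Taggi's proof that a positive loop fugacity shifts the critical point of
the loop-dressed self-avoiding walk (ECP 23 (2018), Thm 1.1, there for the loop O(`n`) model; here for
the strictly dilute loop-dressed SAW `Z_{n,0,y}` = tree `DiluteLoopModel ⟨n, 0, y⟩` on a subgraph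
`H ≤ ℤ²`). For NONNEGATIVE `n, y`:

* `union_mem_cfConfigs_empty`, `mem_cfConfigs_sdiff_iff`, `loops_sdiff_eq_of_avoid`: bookkeeping —
  vertex-disjoint unions of source-free collision-free configurations are again such; the
  source-free collision-free configurations of the punctured volume `Λ ∖ W` are exactly those of `Λ`
  none of whose edges touches `W`, with the same number of closed strands;
* `biUnion_plaquettes`: a family `π i`, `i ∈ I`, of pairwise vertex-disjoint "plaquettes" (source-free
  collision-free configurations with ONE closed strand and `ℓ` edges, all of whose vertices lie in
  `W`) has unions `⋃_{i ∈ T} π i` with `|T|` closed strands and `ℓ |T|` edges;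
* `partitionFunction_sdiff_mul_pow_le` (registered): **the dressing penalty**
  `Z_{n,0,y}(H, Λ ∖ W; ∅) · (1 + n y^ℓ)^{|I|} ≤ Z_{n,0,y}(H, Λ; ∅)` — the map
  `(F, T ⊆ I) ↦ F ∪ ⋃_{i ∈ T} π i` is injective from (configurations of `Λ ∖ W`) × (subfamilies) into
  the configurations of `Λ`, with weight `y^{|F|} n^{loops F} · (n y^ℓ)^{|T|}`, and all other
  configurations of `Λ` weigh `≥ 0`;
* `square_plaquette`: the unit square of `ℤ²` through `x + v(2), …, x + v(5)` (`v` = Kesten's pattern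
  `V = N³ESENES³` of `SAWKestenPatterns.lean`, i.e. the square `x + {(0,2),(0,3),(1,3),(1,2)}`) is such a
  plaquette with `ℓ = 4`, on any `H ≤ ℤ²` containing its four edges — an occurrence of `(V, Q)` on a
  self-avoiding walk through `x` thus carries a plaquette all of whose vertices are WALK vertices.

Sources: L. Taggi, *Shifted critical threshold in the loop O(n) model at arbitrarily small n*,
Electron. Commun. Probab. 23 (2018), proof of Thm 1.1 [Taggi2018]; N. Madras, G. Slade, *The
Self-Avoiding Walk* (1993), §7.2 (patterns) [MadrasSlade1993]; W. Guo, H. Blöte, B. Nienhuis, Int. J.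
Mod. Phys. C 10 (1999) 301, §1 eq. (1) (the weights) [GuoBloteNienhuis1999]. No definitions and no
notations; no statement of the line is asserted here.
-/

noncomputable section

open Finset Filter Topology
open scoped symmDiff
open Literature.Probability.RandomPlanarGeometry Literature.Probability.LatticeModels
open Summit.CriticalPhenomena.SAWScalingLimit.Theorems.AvoidanceLimit.Anchor

namespace Summit.CriticalPhenomena.SAWScalingLimit.Theorems.AvoidanceLimit.Corner

-- No notations and no auxiliary definitions: the collision-free configurations of `H` in the volume
-- `S` with source set `A` are written `(configs H S A).filter (oscVerts S · = ∅)` throughout, the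
-- degree of `z` in `F` as `#(F.filter (z ∈ ·))`.

section Plaquettes

open DiluteLoopModel SimpleGraph DetExpansion

variable {H : SimpleGraph (Site 2)}

/-- Every unordered pair has a member. [folklore] -/
theorem exists_mem_sym2 (e : Sym2 (Site 2)) : ∃ z : Site 2, z ∈ e :=
  Sym2.ind (fun a b => ⟨a, Sym2.mem_mk_left a b⟩) e

/-- Puncturing the volume does not change the number of closed strands of a configuration none of
whose edges touches the puncture (`loops` sees the volume only through the present half-edges).
[folklore] -/
theorem loops_sdiff_eq_of_avoid {Λ W : Finset (Site 2)} {R : Finset (Sym2 (Site 2))}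
    (hav : ∀ e ∈ R, ∀ z ∈ e, z ∉ W) : loops (Λ \ W) R ∅ = loops Λ R ∅ :=
  loops_congr_vol fun y hy =>
    ⟨fun h => (mem_sdiff.1 h).1, fun h => mem_sdiff.2 ⟨h, hav _ hy y.1 (fst_mem_hedge y)⟩⟩

variable [H.LocallyFinite]

/-- **A vertex-disjoint union of two source-free collision-free configurations is one** (degrees add,
and at each vertex one of the two degrees vanishes). [folklore] -/
theorem union_mem_cfConfigs_empty (hH : H ≤ zdGraph 2) {Λ : Finset (Site 2)}
    {F₁ F₂ : Finset (Sym2 (Site 2))} (h₁ : F₁ ∈ ((configs H Λ ∅).filter fun F => oscVerts Λ F = ∅))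
    (h₂ : F₂ ∈ ((configs H Λ ∅).filter fun F => oscVerts Λ F = ∅))
    (hdj : ∀ z : Site 2, ∀ e₁ ∈ F₁, ∀ e₂ ∈ F₂, z ∈ e₁ → z ∉ e₂) :
    F₁ ∪ F₂ ∈ ((configs H Λ ∅).filter fun F => oscVerts Λ F = ∅) := by
  obtain ⟨hsub₁, -, hdeg₁⟩ := (mem_cfConfigs_iff hH).1 h₁
  obtain ⟨hsub₂, -, hdeg₂⟩ := (mem_cfConfigs_iff hH).1 h₂
  refine (mem_cfConfigs_iff hH).2 ⟨union_subset hsub₁ hsub₂, empty_subset _, fun z hz =>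
    ⟨fun h => absurd h (notMem_empty z), fun _ => ?_⟩⟩
  rw [deg_union (vdj_disjoint hdj)]
  by_cases h0 : #(F₁.filter fun e => z ∈ e) = 0
  · rw [h0, zero_add]
    exact (hdeg₂ z hz).2 (notMem_empty z)
  · obtain ⟨e₁, he₁, hze₁⟩ : ∃ e₁ ∈ F₁, z ∈ e₁ := by
      by_contra h
      push Not at h
      exact h0 (deg_eq_zero_iff.2 h)
    have h2 : #(F₂.filter fun e => z ∈ e) = 0 :=
      deg_eq_zero_iff.2 fun e₂ he₂ hze₂ => hdj z e₁ he₁ e₂ he₂ hze₁ hze₂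
    rw [h2, add_zero]
    exact (hdeg₁ z hz).2 (notMem_empty z)

/-- **Configurations of the punctured volume**: the source-free collision-free configurations of
`Λ ∖ W` are exactly those of `Λ` none of whose edges touches `W`. [folklore] -/
theorem mem_cfConfigs_sdiff_iff (hH : H ≤ zdGraph 2) {Λ W : Finset (Site 2)}
    {R : Finset (Sym2 (Site 2))} :
    R ∈ ((configs H (Λ \ W) ∅).filter fun F => oscVerts (Λ \ W) F = ∅) ↔
      R ∈ ((configs H Λ ∅).filter fun F => oscVerts Λ F = ∅) ∧ ∀ e ∈ R, ∀ z ∈ e, z ∉ W := by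
  constructor
  · intro hR
    obtain ⟨hsub, -, hdeg⟩ := (mem_cfConfigs_iff hH).1 hR
    have hav : ∀ e ∈ R, ∀ z ∈ e, z ∉ W := fun e he z hz =>
      (mem_sdiff.1 ((mem_edgesIn_iff.1 (hsub he)).2 z hz)).2
    refine ⟨(mem_cfConfigs_iff hH).2 ⟨fun e he => ?_, empty_subset _, fun z hz =>
      ⟨fun h => absurd h (notMem_empty z), fun _ => ?_⟩⟩, hav⟩
    · have h := mem_edgesIn_iff.1 (hsub he)
      exact mem_edgesIn_iff.2 ⟨h.1, fun z hz => (mem_sdiff.1 (h.2 z hz)).1⟩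
    · by_cases hzW : z ∈ W
      · exact Or.inl (deg_eq_zero_iff.2 fun e he hze => hav e he z hze hzW)
      · exact (hdeg z (mem_sdiff.2 ⟨hz, hzW⟩)).2 (notMem_empty z)
  · rintro ⟨hR, hav⟩
    obtain ⟨hsub, -, hdeg⟩ := (mem_cfConfigs_iff hH).1 hR
    refine (mem_cfConfigs_iff hH).2 ⟨fun e he => ?_, empty_subset _, fun z hz =>
      ⟨fun h => absurd h (notMem_empty z), fun _ => (hdeg z (mem_sdiff.1 hz).1).2 (notMem_empty z)⟩⟩
    have h := mem_edgesIn_iff.1 (hsub he)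
    exact mem_edgesIn_iff.2 ⟨h.1, fun z hz => mem_sdiff.2 ⟨h.2 z hz, hav e he z hz⟩⟩

/-- **Unions of sub-families of pairwise vertex-disjoint plaquettes**: if each `π i`, `i ∈ I`, is a
source-free collision-free configuration of `Λ` with one closed strand and `ℓ` edges, all vertices
in `W`, and distinct members are vertex-disjoint, then for `T ⊆ I` the union `⋃_{i ∈ T} π i` is a
source-free collision-free configuration of `Λ` with `|T|` closed strands, `ℓ |T|` edges and all
vertices in `W`. [folklore] -/
theorem biUnion_plaquettes (hH : H ≤ zdGraph 2) {Λ W : Finset (Site 2)} {ℓ : ℕ} {I : Finset ℕ}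
    {π : ℕ → Finset (Sym2 (Site 2))}
    (hπ : ∀ i ∈ I, π i ∈ ((configs H Λ ∅).filter fun F => oscVerts Λ F = ∅) ∧ loops Λ (π i) ∅ = 1 ∧
      #(π i) = ℓ ∧ ∀ e ∈ π i, ∀ z ∈ e, z ∈ W)
    (hdj : ∀ i ∈ I, ∀ j ∈ I, i ≠ j → ∀ z : Site 2, ∀ e ∈ π i, ∀ e' ∈ π j, z ∈ e → z ∉ e') :
    ∀ T ⊆ I, T.biUnion π ∈ ((configs H Λ ∅).filter fun F => oscVerts Λ F = ∅) ∧
      loops Λ (T.biUnion π) ∅ = #T ∧ #(T.biUnion π) = ℓ * #T ∧ ∀ e ∈ T.biUnion π, ∀ z ∈ e, z ∈ W := by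
  intro T
  induction T using Finset.induction_on with
  | empty =>
    intro _
    refine ⟨mem_filter.2 ⟨?_, ?_⟩, ?_, ?_, ?_⟩ <;> simp [empty_mem_configs]
  | insert i T hi ih =>
    intro hT
    have hiI : i ∈ I := hT (mem_insert_self i T)
    have hTI : T ⊆ I := fun j hj => hT (mem_insert_of_mem hj)
    obtain ⟨hU, hlU, hcU, hWU⟩ := ih hTI
    obtain ⟨hπi, hli, hci, hWi⟩ := hπ i hiI
    have hdjU : ∀ z : Site 2, ∀ e ∈ π i, ∀ e' ∈ T.biUnion π, z ∈ e → z ∉ e' := by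
      intro z e he e' he' hze
      obtain ⟨j, hj, he'j⟩ := mem_biUnion.1 he'
      exact hdj i hiI j (hTI hj) (fun h => hi (h ▸ hj)) z e he e' he'j hze
    rw [biUnion_insert]
    refine ⟨union_mem_cfConfigs_empty hH hπi hU hdjU, ?_, ?_, ?_⟩
    · rw [loops_union_of_vertexDisjoint Λ _ _ hdjU, hlU, hli, card_insert_of_notMem hi, add_comm]
    · rw [card_union_of_disjoint (vdj_disjoint hdjU), hcU, hci, card_insert_of_notMem hi, mul_add,
        mul_one, add_comm]
    · intro e he z hz
      rcases mem_union.1 he with he | he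
      · exact hWi e he z hz
      · exact hWU e he z hz

/-- Injectivity of `(F, T) ↦ F ∪ ⋃_{i ∈ T} π i` on (configurations avoiding `W`) × (subfamilies): one
inclusion. [folklore] -/
theorem subset_of_union_biUnion_eq {Λ W : Finset (Site 2)} {ℓ : ℕ} {I : Finset ℕ}
    {π : ℕ → Finset (Sym2 (Site 2))}
    (hπ : ∀ i ∈ I, π i ∈ ((configs H Λ ∅).filter fun F => oscVerts Λ F = ∅) ∧ loops Λ (π i) ∅ = 1 ∧
      #(π i) = ℓ ∧ ∀ e ∈ π i, ∀ z ∈ e, z ∈ W)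
    (hdj : ∀ i ∈ I, ∀ j ∈ I, i ≠ j → ∀ z : Site 2, ∀ e ∈ π i, ∀ e' ∈ π j, z ∈ e → z ∉ e')
    {R₁ R₂ : Finset (Sym2 (Site 2))} {T₁ T₂ : Finset ℕ} (hR₁ : ∀ e ∈ R₁, ∀ z ∈ e, z ∉ W)
    (hR₂ : ∀ e ∈ R₂, ∀ z ∈ e, z ∉ W) (hT₁ : T₁ ⊆ I) (hT₂ : T₂ ⊆ I)
    (h : R₁ ∪ T₁.biUnion π = R₂ ∪ T₂.biUnion π) : R₁ ⊆ R₂ ∧ T₁ ⊆ T₂ := by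
  refine ⟨fun e he => ?_, fun i hi => ?_⟩
  · have he' : e ∈ R₂ ∪ T₂.biUnion π := h ▸ mem_union_left _ he
    rcases mem_union.1 he' with he' | he'
    · exact he'
    · exfalso
      obtain ⟨j, hj, hej⟩ := mem_biUnion.1 he'
      obtain ⟨z, hz⟩ := exists_mem_sym2 e
      exact hR₁ e he z hz ((hπ j (hT₂ hj)).2.2.2 e hej z hz)
  · obtain ⟨hπi, hli, -, hWi⟩ := hπ i (hT₁ hi)
    have hne : (π i).Nonempty := by
      rw [nonempty_iff_ne_empty]
      rintro h0
      rw [h0, loops_empty] at hli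
      exact zero_ne_one hli
    obtain ⟨e, he⟩ := hne
    obtain ⟨z, hz⟩ := exists_mem_sym2 e
    have he' : e ∈ R₂ ∪ T₂.biUnion π := h ▸ mem_union_right _ (mem_biUnion.2 ⟨i, hi, he⟩)
    rcases mem_union.1 he' with he' | he'
    · exact absurd (hWi e he z hz) (hR₂ e he' z hz)
    · obtain ⟨j, hj, hej⟩ := mem_biUnion.1 he'
      by_contra hiT
      have hij : i ≠ j := fun hij => hiT (hij ▸ hj)
      exact hdj i (hT₁ hi) j (hT₂ hj) hij z e he e hej hz hz

/-- **Registered helper · the dressing penalty (walk-supported plaquettes only raise the source-free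
partition function).** On `H ≤ ℤ²` with loop fugacity `n ≥ 0` and edge fugacity `y ≥ 0`: if `π i`,
`i ∈ I`, are pairwise vertex-disjoint source-free collision-free configurations of `Λ`, each with one
closed strand and `ℓ` edges (e.g. unit squares, `ℓ = 4`) and all vertices in `W`, then
`Z_{n,0,y}(H, Λ ∖ W; ∅) · (1 + n y^ℓ)^{|I|} ≤ Z_{n,0,y}(H, Λ; ∅)`: expanding the binomial, the left side
is the sum over (configuration `F` of `Λ ∖ W`, subfamily `T ⊆ I`) of the weight
`y^{|F| + ℓ|T|} n^{loops F + |T|}` of the configuration `F ∪ ⋃_{i∈T} π i` of `Λ` (a vertex-disjoint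
union: `F` lives off `W`, the plaquettes on `W`), the map `(F, T) ↦ F ∪ ⋃_T π i` is injective, and the
remaining configurations of `Λ` have nonnegative weight. This is the "each pattern can be dressed by
a small loop at cost `n y^4`" step of Taggi's argument. [cite: Taggi2018, proof of Thm 1.1] -/
theorem partitionFunction_sdiff_mul_pow_le :
    ∀ (H : SimpleGraph (Site 2)) [H.LocallyFinite], H ≤ zdGraph 2 → ∀ (n y : ℝ), 0 ≤ n → 0 ≤ y →
      ∀ (ℓ : ℕ) (Λ W : Finset (Site 2)) (I : Finset ℕ) (π : ℕ → Finset (Sym2 (Site 2))),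
        (∀ i ∈ I, π i ∈ (DiluteLoopModel.configs H Λ ∅).filter
              (fun F => DiluteLoopModel.oscVerts Λ F = ∅) ∧
            DiluteLoopModel.loops Λ (π i) ∅ = 1 ∧ #(π i) = ℓ ∧ ∀ e ∈ π i, ∀ z ∈ e, z ∈ W) →
        (∀ i ∈ I, ∀ j ∈ I, i ≠ j → ∀ z : Site 2, ∀ e ∈ π i, ∀ e' ∈ π j, z ∈ e → z ∉ e') →
        (⟨n, 0, y⟩ : DiluteLoopModel ℝ).partitionFunction H (Λ \ W) ∅ * (1 + n * y ^ ℓ) ^ #I ≤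
          (⟨n, 0, y⟩ : DiluteLoopModel ℝ).partitionFunction H Λ ∅ := by
  intro H _ hH n y hn hy ℓ Λ W I π hπ hdj
  classical
  have hfam := biUnion_plaquettes hH hπ hdj
  have hbin : (1 + n * y ^ ℓ) ^ #I = ∑ T ∈ I.powerset, (n * y ^ ℓ) ^ #T := by
    rw [add_comm, ← Finset.sum_pow_mul_eq_add_pow]
    simp only [one_pow, mul_one]
  rw [partitionFunction_dilute_eq_sum, partitionFunction_dilute_eq_sum, hbin, sum_mul_sum,
    ← sum_product']
  set C := ((configs H (Λ \ W) ∅).filter fun F => oscVerts (Λ \ W) F = ∅) with hC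
  set φ : Finset (Sym2 (Site 2)) × Finset ℕ → Finset (Sym2 (Site 2)) :=
    fun q => q.1 ∪ q.2.biUnion π with hφ
  set g : Finset (Sym2 (Site 2)) → ℝ := fun G => y ^ #G * n ^ loops Λ G ∅ with hg
  -- the data of a pair `(F, T)`
  have hdata : ∀ q ∈ C ×ˢ I.powerset,
      (q.1 ∈ ((configs H Λ ∅).filter fun F => oscVerts Λ F = ∅) ∧ ∀ e ∈ q.1, ∀ z ∈ e, z ∉ W) ∧
        q.2 ⊆ I ∧ ∀ z : Site 2, ∀ e ∈ q.1, ∀ e' ∈ q.2.biUnion π, z ∈ e → z ∉ e' := by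
    intro q hq
    obtain ⟨hq1, hq2⟩ := mem_product.1 hq
    have h1 := (mem_cfConfigs_sdiff_iff hH).1 hq1
    have h2 : q.2 ⊆ I := mem_powerset.1 hq2
    exact ⟨h1, h2, fun z e he e' he' hze hze' => h1.2 e he z hze ((hfam q.2 h2).2.2.2 e' he' z hze')⟩
  have hweight : ∀ q ∈ C ×ˢ I.powerset,
      y ^ #q.1 * n ^ loops (Λ \ W) q.1 ∅ * (n * y ^ ℓ) ^ #q.2 = g (φ q) := by
    intro q hq
    obtain ⟨⟨-, hav⟩, h2, hdjq⟩ := hdata q hq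
    obtain ⟨-, hlU, hcU, -⟩ := hfam q.2 h2
    simp only [hg, hφ]
    rw [card_union_of_disjoint (vdj_disjoint hdjq), loops_union_of_vertexDisjoint Λ _ _ hdjq, hlU, hcU,
      loops_sdiff_eq_of_avoid hav, pow_add, pow_add, pow_mul, mul_pow]
    ring
  have hinj : ∀ q₁ ∈ C ×ˢ I.powerset, ∀ q₂ ∈ C ×ˢ I.powerset, φ q₁ = φ q₂ → q₁ = q₂ := by
    intro q₁ hq₁ q₂ hq₂ h
    obtain ⟨⟨-, hav₁⟩, hT₁, -⟩ := hdata q₁ hq₁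
    obtain ⟨⟨-, hav₂⟩, hT₂, -⟩ := hdata q₂ hq₂
    obtain ⟨hR, hT⟩ := subset_of_union_biUnion_eq hπ hdj hav₁ hav₂ hT₁ hT₂ h
    obtain ⟨hR', hT'⟩ := subset_of_union_biUnion_eq hπ hdj hav₂ hav₁ hT₂ hT₁ h.symm
    exact Prod.ext (Subset.antisymm hR hR') (Subset.antisymm hT hT')
  have himage : (C ×ˢ I.powerset).image φ ⊆ ((configs H Λ ∅).filter fun F => oscVerts Λ F = ∅) := by
    rw [image_subset_iff]
    intro q hq
    obtain ⟨⟨hq1, -⟩, h2, hdjq⟩ := hdata q hq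
    exact union_mem_cfConfigs_empty hH hq1 (hfam q.2 h2).1 hdjq
  calc ∑ q ∈ C ×ˢ I.powerset, y ^ #q.1 * n ^ loops (Λ \ W) q.1 ∅ * (n * y ^ ℓ) ^ #q.2
      = ∑ q ∈ C ×ˢ I.powerset, g (φ q) := sum_congr rfl hweight
    _ = ∑ G ∈ (C ×ˢ I.powerset).image φ, g G := (sum_image hinj).symm
    _ ≤ ∑ G ∈ ((configs H Λ ∅).filter fun F => oscVerts Λ F = ∅), g G :=
        sum_le_sum_of_subset_of_nonneg himage fun G _ _ => mul_nonneg (pow_nonneg hy _) (pow_nonneg hn _)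
    _ = ∑ G ∈ ((configs H Λ ∅).filter fun F => oscVerts Λ F = ∅), y ^ #G * n ^ loops Λ G ∅ := rfl

/-- **The unit square through `x + v(2), x + v(3), x + v(4), x + v(5)` is a plaquette**: on
`H ≤ ℤ²` containing its four edges, with its four vertices in `Λ`, its edge set is a source-free
collision-free configuration of `Λ` with exactly one closed strand and four edges, every vertex of
which is one of the `x + v(t)`, `2 ≤ t ≤ 5` (`v` = Kesten's pattern `V`, `SAW.Zd.vPt`; the square is
`x + {(0,2), (0,3), (1,3), (1,2)}`). [cite: MadrasSlade1993, Theorem 7.3.2 (proof), Fig. 7.4] -/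
theorem square_plaquette (hH : H ≤ zdGraph 2) {Λ : Finset (Site 2)} (x : Site 2)
    {E : Finset (Sym2 (Site 2))}
    (hE : E = {s(x + SAW.Zd.vPt 2, x + SAW.Zd.vPt 5), s(x + SAW.Zd.vPt 2, x + SAW.Zd.vPt 3),
      s(x + SAW.Zd.vPt 3, x + SAW.Zd.vPt 4), s(x + SAW.Zd.vPt 4, x + SAW.Zd.vPt 5)})
    (h23 : H.Adj (x + SAW.Zd.vPt 2) (x + SAW.Zd.vPt 3)) (h34 : H.Adj (x + SAW.Zd.vPt 3) (x + SAW.Zd.vPt 4))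
    (h45 : H.Adj (x + SAW.Zd.vPt 4) (x + SAW.Zd.vPt 5)) (h25 : H.Adj (x + SAW.Zd.vPt 2) (x + SAW.Zd.vPt 5))
    (hΛ : ∀ t : ℕ, 2 ≤ t → t ≤ 5 → x + SAW.Zd.vPt t ∈ Λ) :
    E ∈ ((configs H Λ ∅).filter fun F => oscVerts Λ F = ∅) ∧ loops Λ E ∅ = 1 ∧ #E = 4 ∧
      ∀ e ∈ E, ∀ z ∈ e, ∃ t : ℕ, 2 ≤ t ∧ t ≤ 5 ∧ z = x + SAW.Zd.vPt t := by
  classical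
  subst hE
  have hne : ∀ s t : ℕ, s ≤ 11 → t ≤ 11 → s ≠ t → x + SAW.Zd.vPt s ≠ x + SAW.Zd.vPt t :=
    fun s t hs ht hst h => hst (SAW.Zd.vPt_injOn x hs ht h)
  have h23' := hne 2 3 (by norm_num) (by norm_num) (by norm_num)
  have h24' := hne 2 4 (by norm_num) (by norm_num) (by norm_num)
  have h25' := hne 2 5 (by norm_num) (by norm_num) (by norm_num)
  have h34' := hne 3 4 (by norm_num) (by norm_num) (by norm_num)
  have h35' := hne 3 5 (by norm_num) (by norm_num) (by norm_num)
  have h45' := hne 4 5 (by norm_num) (by norm_num) (by norm_num)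
  set w : H.Walk (x + SAW.Zd.vPt 2) (x + SAW.Zd.vPt 5) :=
    Walk.cons h23 (Walk.cons h34 (Walk.cons h45 Walk.nil)) with hw
  have hwp : w.IsPath := by
    refine ((Walk.IsPath.nil.cons ?_).cons ?_).cons ?_ <;> simp [h23', h24', h25', h34', h35', h45']
  have hsupp : ∀ z ∈ w.support, ∃ t : ℕ, 2 ≤ t ∧ t ≤ 5 ∧ z = x + SAW.Zd.vPt t := by
    intro z hz
    simp only [hw, Walk.support_cons, Walk.support_nil, List.mem_cons, List.not_mem_nil, or_false] at hz
    rcases hz with rfl | rfl | rfl | rfl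
    · exact ⟨2, by norm_num, by norm_num, rfl⟩
    · exact ⟨3, by norm_num, by norm_num, rfl⟩
    · exact ⟨4, by norm_num, by norm_num, rfl⟩
    · exact ⟨5, by norm_num, by norm_num, rfl⟩
  have hΛw : ∀ z ∈ w.support, z ∈ Λ := fun z hz => by
    obtain ⟨t, ht2, ht5, rfl⟩ := hsupp z hz
    exact hΛ t ht2 ht5
  have hedges : w.edges.toFinset = {s(x + SAW.Zd.vPt 2, x + SAW.Zd.vPt 3),
      s(x + SAW.Zd.vPt 3, x + SAW.Zd.vPt 4), s(x + SAW.Zd.vPt 4, x + SAW.Zd.vPt 5)} := by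
    simp [hw]
  have hnot : s(x + SAW.Zd.vPt 2, x + SAW.Zd.vPt 5) ∉ w.edges.toFinset := by
    rw [hedges]
    simp [h23', h24', h25', Ne.symm h25', Ne.symm h35', Ne.symm h45']
  have h1 : ({s(x + SAW.Zd.vPt 2, x + SAW.Zd.vPt 5), s(x + SAW.Zd.vPt 2, x + SAW.Zd.vPt 3),
      s(x + SAW.Zd.vPt 3, x + SAW.Zd.vPt 4), s(x + SAW.Zd.vPt 4, x + SAW.Zd.vPt 5)} :
        Finset (Sym2 (Site 2))) = insert s(x + SAW.Zd.vPt 2, x + SAW.Zd.vPt 5) w.edges.toFinset := by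
    rw [hedges]
  have hcf' : w.edges.toFinset ∈
      ((configs H Λ ({x + SAW.Zd.vPt 2} ∆ {x + SAW.Zd.vPt 5})).filter fun F => oscVerts Λ F = ∅) :=
    mem_filter.2 ⟨edgesFinset_mem_configs hwp h25' hΛw, oscVerts_edges_eq_empty hH hwp Λ⟩
  refine ⟨?_, ?_, ?_, ?_⟩
  · rw [h1]
    refine insert_mem_cfConfigs hH hcf' h25 (hΛ 2 (by norm_num) (by norm_num))
      (hΛ 5 (by norm_num) (by norm_num)) hnot Subset.rfl (empty_subset _)
      (fun z hz hz' => absurd hz hz') (fun z _ hz => ?_) (fun z _ hz => ?_)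
    · rw [Sym2.mem_iff, not_or] at hz
      simp [mem_symmDiff, hz.1, hz.2]
    · refine ⟨?_, notMem_empty z⟩
      rcases Sym2.mem_iff.1 hz with rfl | rfl
      · simp [mem_symmDiff, h25']
      · simp [mem_symmDiff, Ne.symm h25']
  · rw [h1]
    exact loops_cycle_eq_one hH hwp hΛw h25 hnot
  · rw [h1, card_insert_of_notMem hnot, IsPath.card_edges_toFinset hwp]
    simp [hw]
  · intro e he z hz
    rw [h1, mem_insert] at he
    rcases he with rfl | he
    · rcases Sym2.mem_iff.1 hz with rfl | rfl
      · exact ⟨2, by norm_num, by norm_num, rfl⟩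
      · exact ⟨5, by norm_num, by norm_num, rfl⟩
    · exact hsupp z (mem_support_of_mem_edges_toFinset w e he z hz)

end Plaquettes

end Summit.CriticalPhenomena.SAWScalingLimit.Theorems.AvoidanceLimit.Corner

end
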